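import Summits.BirchSwinnertonDyer.BirchSwinnertonDyer.Theses.BiquadraticEisensteinDescent
import Literature.NumberTheory.QuadraticFields.ClassNumberLeSqrtMulLog
import Literature.NumberTheory.EllipticCurves.NonvanishingTwists
import Literature.NumberTheory.EllipticCurves.Kriz2020.GoldfeldJ1728Proofs
import Mathlib.NumberTheory.LegendreSymbol.JacobiSymbol
import Mathlib.Analysis.SpecialFunctions.Log.Basic

/-!
# Sketch — crux-ideate seat 2 (g10), `stmt-BirchSwinnertonDyer-21381` `HeegnerTwistCouplingInSupply`

First-lemma signatures for the crux idea card `sturm-heegner-log-gap`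
(EFFECTIVE Waldspurger by the Sturm bound on the Heegner-selected `U_p`-image of the fixed
weight-3/2 form of `W₀`, for the quadratic-twist corner `W = W₀^{(±p)}`; the residual of the crux on
that corner is a LOG-GAP at the convexity threshold `|d| ≍ p² ≍ N_W`).
Planner sketch: nothing here is proved, nothing is filed as a statement item.  BSD is not proved
by this.
-/

open scoped Classical
open Literature.NumberTheory.EllipticCurves

namespace Summit.BirchSwinnertonDyer.BirchSwinnertonDyer.Cruxes.HeegnerTwistCouplingInSupply.SturmHeegnerLogGap

/-- The crux, by name. -/
abbrev Crux : Prop :=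
  Summit.BirchSwinnertonDyer.BirchSwinnertonDyer.Theses.BiquadraticEisensteinDescent.HeegnerTwistCouplingInSupply

/-- Heegner-admissible twist parameter for the congruent corner curves `E_p` (`p ≡ 7 (mod 8)`,
`N = 32p²`) and `E_{2p}` (`p ≡ 3 (mod 4)`, `N = 64p²`): `d = −m` with `m ≡ 7 (mod 8)` squarefree
(so `d ≡ 1 (mod 8)`: `2` splits, `|d| = m ≥ 7 > 4`), `p ∤ m`, `(−m/p) = +1` (`p` splits). -/
def HeegnerSel (p m : ℕ) : Prop :=
  m % 8 = 7 ∧ Squarefree m ∧ ¬ p ∣ m ∧ jacobiSym (-(m : ℤ)) p = 1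

/-- A non-vanishing Heegner twist of `E_p = y² = x³ − p²x` inside the window `m ≤ B p`
(`E_p^{(−m)} = E_{pm}`, tree lemma `quadraticTwist_congruentNumberCurve`). -/
def NonvanishingHeegnerWindow (B : ℕ → ℝ) : Prop :=
  ∀ p : ℕ, p.Prime → p % 8 = 7 →
    ∃ m : ℕ, HeegnerSel p m ∧ (m : ℝ) ≤ B p ∧ (congruentNumberCurve (p * m)).entireLFunction 1 ≠ 0

/-- Same for the second corner family `E_{2p}`, `p ≡ 3 (mod 4)` (`E_{2p}^{(−m)} = E_{2pm}`). -/
def NonvanishingHeegnerWindow₂ (B : ℕ → ℝ) : Prop :=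
  ∀ p : ℕ, p.Prime → p % 4 = 3 → 5 ≤ p → (congruentNumberCurve (2 * p)).rootNumber = -1 →
    ∃ m : ℕ, HeegnerSel p m ∧ (m : ℝ) ≤ B p ∧
      (congruentNumberCurve (2 * p * m)).entireLFunction 1 ≠ 0

/-- **FIRST LEMMA = the RUNG (Sturm–Waldspurger–Tunnell window, unconditional in print).**
`F_p := ½(A + A ⊗ χ_p)` with `A := Σ_{p ∤ m, m ≡ 7 (8)} a(pm) q^m = (U_p g₁ − V_p U_p U_p g₁)^{[7 mod 8]}`,
`g₁ ∈ S_{3/2}(128)` Tunnell's form (`a(n) = #{2x²+y²+32z² = n} − ½ #{2x²+y²+8z² = n}`), lies in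
`S_{3/2}(Γ₀(128 p²), ψ)`; it is `≢ 0` by Waldspurger 1985 (tree fact
`waldspurger_exists_heegnerField_twist_ne_zero`) and Tunnell/Waldspurger 1981 (`a(pm)² ∝ L(E_{pm},1)√(pm)`);
Sturm (`ord_∞ F ≤ (3/2)/12 · [SL₂ℤ : Γ₀(128p²)] = 24 p (p+1)`) gives the window.  Folklore shape
"Waldspurger + Riemann–Roch ⇒ least non-vanishing twist `≪ N^{1+ε}`" is in print
([LPST20] = arXiv:2007.07765 p.3; [RaumXia19] = arXiv:1908.03616 p.9); here with the Heegner
selection at `2` and `p` made explicit.  Numerically `m*(p) ≤ 95` for all 565 primes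
`p ≡ 7 (mod 8)` below `2·10⁴` (folder `falsifier_g10_sturm_P20000.txt`). -/
def SturmHeegnerWindow : Prop :=
  NonvanishingHeegnerWindow (fun p => 24 * (p : ℝ) * ((p : ℝ) + 1))

/-- The `E_{2p}` rung (Tunnell's even form, level `128`, same Sturm window up to the `2`-part). -/
def SturmHeegnerWindow₂ : Prop :=
  NonvanishingHeegnerWindow₂ (fun p => 48 * (p : ℝ) * ((p : ℝ) + 1))

/-- **C⁺ of the line (the LOG-GAP).** The same non-vanishing inside the class-number-free window
`m ≤ p² / (log p)³` — i.e. `ord_∞ F_p ≤ p²/log³p`, a saving of `(log p)^{3+o(1)}` over the Sturm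
bound AT the convexity threshold `|d| ≍ N_W` (not a power saving below it).  Equivalent analytic
form: the first moment `Σ_{m ≤ Y, m ∈ Sel_p} L(E_{pm}, 1)` is `> 0` at `Y = p²/log³p`; the family is a
GL(1) family over `ℚ(i)` (`f₃₂ = θ_ψ` is CM) twisted by the fixed character `χ_p`, and the
conductor-drop heuristic of [LPST20, §1.2] (`N = N₀N₁²`, `N₁ = p`, `N₀ = 32`) places the Poisson
dead-lock at `Y ≍ p`, a power BELOW the target `Y ≍ p²/log³p`. -/
def LogGapHeegnerWindow : Prop :=
  NonvanishingHeegnerWindow (fun p => (p : ℝ) ^ 2 / (Real.log p) ^ 3)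

/-- `E_{2p}` version of C⁺. -/
def LogGapHeegnerWindow₂ : Prop :=
  NonvanishingHeegnerWindow₂ (fun p => (p : ℝ) ^ 2 / (Real.log p) ^ 3)

/-- **Size frees the class number (M-sized, from the tree theorem
`Quadratic.classNumber_le_sqrt_mul_log`: `h(−m) ≤ π⁻¹ √m log m`).** For `7 ≤ m ≤ p²/log³p`:
`h(ℚ(√−m)) ≤ π⁻¹ (p / log^{3/2} p)(2 log p) = (2/π) p /√(log p) < p`, hence `p ∤ h`. -/
def SizeFreesClassNumber : Prop :=
  ∀ p m : ℕ, p.Prime → 3 ≤ p → 7 ≤ m → m % 4 = 3 → (m : ℝ) ≤ (p : ℝ) ^ 2 / (Real.log p) ^ 3 →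
    ∀ (K : Type) [Field K] [NumberField K], IsImaginaryQuadratic K →
      NumberField.discr K = -(m : ℤ) → ¬ p ∣ NumberField.classNumber K


/-- **Target of the line on the prime congruent sub-corner** (verbatim copy of g5's
`CruxOnPrimeCongruentCurves`, which lives in an unbuilt crux workfile):
`W = E_p : y² = x³ − p²x`, `p ≡ 7 (mod 8)` — literally the conclusion of `HeegnerTwistCouplingInSupply`
for these `W`, with `K′ = ℚ(√−m)` and `W^{(d_{K′})} = E_{pm}`. -/
def CruxOnPrimeCongruentCurves : Prop :=
  ∀ (p : ℕ) [Fact p.Prime] [(congruentNumberCurve p).IsElliptic]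
    [(congruentNumberCurve p).IsGloballyMinimal] [NeZero ((congruentNumberCurve p).conductorNorm ℤ)],
    p % 8 = 7 →
    ∃ (K : Type) (_ : Field K) (_ : NumberField K),
      IsImaginaryQuadratic K ∧ 4 < (NumberField.discr K).natAbs ∧
      SatisfiesHeegnerHypothesis ((congruentNumberCurve p).conductorNorm ℤ) K ∧
      ((congruentNumberCurve p).quadraticTwist (NumberField.discr K : ℚ)).entireLFunction 1 ≠ 0 ∧
      ¬ p ∣ NumberField.classNumber K

/-- The same target for `W = E_{2p}`, `p ≡ 3 (mod 4)` (copy of g5's `CruxOnTwicePrimeCongruentCurves`). -/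
def CruxOnTwicePrimeCongruentCurves : Prop :=
  ∀ (p : ℕ) [Fact p.Prime] [(congruentNumberCurve (2 * p)).IsElliptic]
    [(congruentNumberCurve (2 * p)).IsGloballyMinimal]
    [NeZero ((congruentNumberCurve (2 * p)).conductorNorm ℤ)],
    p % 4 = 3 → (congruentNumberCurve (2 * p)).analyticRank = 1 →
    ∃ (K : Type) (_ : Field K) (_ : NumberField K),
      IsImaginaryQuadratic K ∧ 4 < (NumberField.discr K).natAbs ∧
      SatisfiesHeegnerHypothesis ((congruentNumberCurve (2 * p)).conductorNorm ℤ) K ∧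
      ((congruentNumberCurve (2 * p)).quadraticTwist (NumberField.discr K : ℚ)).entireLFunction 1 ≠ 0 ∧
      ¬ p ∣ NumberField.classNumber K

/-- **Corner reduction (statement).** C⁺ + size ⇒ the crux on the prime congruent sub-corner
(g5's corner target, copied below: `W = E_p`, `K′ = ℚ(√−m)`, `W^{(d_{K′})} = E_{pm}`, Heegner for
`N_W = 32p²` from `−m ≡ 1 (mod 8)` and `(−m/p) = 1`; finitely many `p` below the log-gap threshold
are a finite Tunnell computation, cf. the falsifier table). -/
def CornerReduction : Prop :=
  LogGapHeegnerWindow → SizeFreesClassNumber → CruxOnPrimeCongruentCurves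

/-- The `E_{2p}` corner reduction. -/
def CornerReduction₂ : Prop :=
  LogGapHeegnerWindow₂ → SizeFreesClassNumber → CruxOnTwicePrimeCongruentCurves

/-- **General-corner form of the rung, in the crux's own binders (EFFECTIVE Waldspurger).**
For the CM inert-bad corner `N_W = N₀ p²` the least Heegner field with a non-vanishing twist has
`|d_K| ≤ κ(N₀) · p²` (Sturm on the Heegner-selected weight-3/2 Waldspurger form of level
`c(N₀) p²`; for the sextic/quartic corners the level of the metaplectic newvector at the
supercuspidal prime `p` is to be confirmed — Ueda–Yamana newform theory).  Compare the qualitative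
tree fact `waldspurger_exists_heegnerField_twist_ne_zero` (no bound). -/
def EffectiveHeegnerTwistWindow (κ : ℕ → ℝ) : Prop :=
  ∀ (W : WeierstrassCurve ℚ) [W.IsElliptic] [W.IsGloballyMinimal] (p N₀ : ℕ) [Fact p.Prime]
    [NeZero (W.conductorNorm ℤ)],
    W.HasCM → W.rootNumber = -1 → 5 ≤ p → Rank1Residual.CMInert W p → ¬ Rank1Residual.Good W p →
    W.conductorNorm ℤ = N₀ * p ^ 2 → ¬ p ∣ N₀ →
    ∃ (K : Type) (_ : Field K) (_ : NumberField K),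
      IsImaginaryQuadratic K ∧ 4 < (NumberField.discr K).natAbs ∧
      SatisfiesHeegnerHypothesis (W.conductorNorm ℤ) K ∧
      (W.quadraticTwist (NumberField.discr K : ℚ)).entireLFunction 1 ≠ 0 ∧
      ((NumberField.discr K).natAbs : ℝ) ≤ κ N₀ * (p : ℝ) ^ 2

/-- **General-corner C⁺ (log gap) and its consequence for the crux:** with the window
`κ(N₀) p² / log³ p` the class number of `K` is `< p` for `p ≥ p₀(N₀)`, so the crux holds on the
whole large-`p` corner; the finitely many `p < p₀(N₀)` per `N₀` are NOT covered (small-`p` tail =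
the lead's `size_tail` line). -/
def LogGapCorner (κ : ℕ → ℝ) : Prop :=
  ∀ (W : WeierstrassCurve ℚ) [W.IsElliptic] [W.IsGloballyMinimal] (p N₀ : ℕ) [Fact p.Prime]
    [NeZero (W.conductorNorm ℤ)],
    W.HasCM → W.rootNumber = -1 → 5 ≤ p → Rank1Residual.CMInert W p → ¬ Rank1Residual.Good W p →
    W.conductorNorm ℤ = N₀ * p ^ 2 → ¬ p ∣ N₀ →
    ∃ (K : Type) (_ : Field K) (_ : NumberField K),
      IsImaginaryQuadratic K ∧ 4 < (NumberField.discr K).natAbs ∧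
      SatisfiesHeegnerHypothesis (W.conductorNorm ℤ) K ∧
      (W.quadraticTwist (NumberField.discr K : ℚ)).entireLFunction 1 ≠ 0 ∧
      ((NumberField.discr K).natAbs : ℝ) ≤ κ N₀ * (p : ℝ) ^ 2 / (Real.log p) ^ 3

/-- Shape check: the twist of `E_p` by `d = −m` is `E_{pm}` (tree lemma). -/
example (p m : ℕ) :
    (congruentNumberCurve p).quadraticTwist ((-(m : ℤ) : ℤ) : ℚ) = congruentNumberCurve (p * m) := by
  rw [quadraticTwist_congruentNumberCurve, Int.natAbs_neg, Int.natAbs_natCast]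

end Summit.BirchSwinnertonDyer.BirchSwinnertonDyer.Cruxes.HeegnerTwistCouplingInSupply.SturmHeegnerLogGap
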